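import Literature.Probability.FitznerVanDerHofstad2017.Stage1TabsD10
import Summits.CriticalPhenomena.LaceExpansionHighD.TrailCountN14X0
import HarnessLib

/-!
# Link line for the `d := 10` what-if stage-1 table: `nrBAW v0` at `n = 14` (retires one R823-rider entry)

Programme-side complement of `Literature/…/FitznerVanDerHofstad2017/Stage1TabsD10` §F (pattern of `SawCountD11LinkExt` /
`Stage1TabsD10LinkExt` / `Stage1TabsD10LinkN15X5`): the kernel class theorem `card_trailWordsTo_n14_x0` (`TrailCountN14X0*`,
machine `trailCodeF` / `trailCodeT` of `TrailCountKernel`, 21 932 858 recursion nodes; fresh-direction coefficients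
`N_j = [0, 0, 4018, 497525, 2535470, 2382310, 621943, 43580]`) evaluates at `d = 10` to `11 904 778 806 480`
(`card_trailWordsTo_n14_x0_d10`) = the audited table entry `Stage1Cells.CertD10.bawRows .v0` at `j = 14` — the closed-trail
count `nrBAW[14,10,v0]`, which the typed Stage 1 READS at the what-if tuples `P = (10,18,36)` and `(10,18,40)` (`Stage1EvalD10`
docstring list of displayed entries, R823 rider).  After this module that entry is a tree theorem.  What-if / input-certification
lane: no `Inputs` record, no `…Of 10`, nothing here is a certificate of any mean-field statement; no facts, no hypotheses.
-/

namespace Summit.CriticalPhenomena.LaceExpansionHighD.TabsD10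

open Literature.Probability.LatticeModels Literature.Probability.Percolation
open Literature.Probability.FitznerVanDerHofstad2017

/-- LINK: `nrBAW[14,10,v0] = a_14(0; 10)` — the audited table entry `Stage1Cells.CertD10.bawRows .v0` at `j = 14` IS the
closed-trail count `#trailWordsTo 10 14 0 = 11904778806480` (read at `P = (10,18,36)` and `(10,18,40)`; previously displayed). -/
theorem bawRows_v0_getD_14 :
    (Stage1Cells.CertD10.bawRows .v0).getD 14 0 = ((trailWordsTo 10 14 (siteOfList [] 10)).card : ℚ) := by
  rw [card_trailWordsTo_n14_x0_d10]; norm_num [Stage1Cells.CertD10.bawRows]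

/-- **nrBAW row at `v0`, packaged:** `tabsHi.baw j v0 = #trailWordsTo 10 j 0` for every `1 ≤ j ≤ 15`
(`Stage1TabsD10.tabsHi_baw_v0_eq_card` gives `1 ≤ j ≤ 13`; `j = 14` is `bawRows_v0_getD_14` above, `j = 15` the parity zero
`Stage1Cells.CertD10.bawRows_v0_getD_15`; `j = 0` stays excluded as in `Stage1TabsD10` — the table lists `0` there). -/
theorem tabsHi_baw_v0_eq_card15 (j : ℕ) (hj' : 1 ≤ j) (hj : j ≤ 15) :
    Stage1Cells.CertD10.tabsHi.baw j .v0 = ((trailWordsTo 10 j (siteOfList [] 10)).card : ℚ) := by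
  rcases Nat.lt_or_ge j 14 with h | h
  · exact Stage1Cells.CertD10.tabsHi_baw_v0_eq_card j hj' (by omega)
  · show (Stage1Cells.CertD10.bawRows .v0).getD j 0 = _
    interval_cases j
    · exact bawRows_v0_getD_14
    · exact Stage1Cells.CertD10.bawRows_v0_getD_15

end Summit.CriticalPhenomena.LaceExpansionHighD.TabsD10
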